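import Literature.AnabelianGeometry.Anabelioids.ProSigmaProofs
import Mathlib.Topology.Algebra.Category.ProfiniteGrp.Basic
import Mathlib.Topology.Algebra.ClopenNhdofOne
import Mathlib.Topology.Algebra.OpenSubgroup
import HarnessLib

/-!
# The kernel of the maximal pro-`Σ` quotient has no `Σ`-quotients ([AbsTopI] Def 1.1 (iii))

S. Mochizuki, *Topics in Absolute Anabelian Geometry I: Generalities* (2012) [AbsTopI] (lit key
`paper:url-11ac98ba15fc`), Def 1.1 (iii) p. 10: "We shall refer to a quotient `G ↠ Q` as almost
pro-`Σ`-maximal if for some normal open subgroup `N ⊆ G` with maximal pro-`Σ` quotient `N ↠ P`, we have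
`Ker(G ↠ Q) = Ker(N ↠ P)`."  The kernel `K := Ker(N ↠ P)` of the maximal pro-`Σ` quotient of a profinite
group `N` is the intersection of the open normal subgroups of `N` of `Σ`-integer index.  This PROOF-ONLY
file (no definitions: `K` enters through the membership hypothesis
`hK : ∀ x, x ∈ K ↔ ∀ W, W.Normal → IsOpen W → IsSigmaInteger Σ [N : W] → x ∈ W`) proves the basic
structural fact used in the proof of [AbsTopI] Thm 1.7 (ii) (elasticity of almost pro-`p`-maximal
quotients, p. 14–15): **`K` has no nontrivial finite `Σ`-quotients** — every open normal subgroup `V` of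
`K` of `Σ`-integer index is `K` itself (`le_of_isSigmaInteger_relIndex`, "an extension of a pro-`Σ` group by
a pro-`Σ` group is pro-`Σ`", read through a finite quotient `N/C`), together with the compactness lemma
`exists_finset_of_isOpen_of_forall_mem` (an open subgroup containing an intersection of closed subgroups
contains a finite sub-intersection) and the closure properties of the family of open normal `Σ`-index
subgroups.  Classical profinite group theory (cf. [RZ] §3.4); nothing here bears on [IUTchIII] Cor. 3.12.
-/

noncomputable section

open Topology

universe u

namespace Literature.AnabelianGeometry.AbsoluteAnabelian

open Literature.AnabelianGeometry.Anabelioids (IsSigmaInteger)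

variable {G : Type u} [Group G] [TopologicalSpace G]

/-! ### Compactness: open subgroups containing an intersection of closed subgroups -/

/-- In a compact group, an open subgroup `U` containing the intersection of a family of CLOSED subgroups
(those satisfying `P`) already contains the intersection of finitely many of them.
[cite: MochizukiAbsTopI2012, Def 1.1 (iii) p.10] -/
theorem exists_finset_of_isOpen_of_forall_mem [CompactSpace G] (P : Subgroup G → Prop)
    (hP : ∀ W, P W → IsClosed (W : Set G)) (U : Subgroup G) (hU : IsOpen (U : Set G))
    (hle : ∀ x, (∀ W, P W → x ∈ W) → x ∈ U) :
    ∃ F : Finset (Subgroup G), (∀ W ∈ F, P W) ∧ ∀ x, (∀ W ∈ F, x ∈ W) → x ∈ U := by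
  classical
  have hcpt : IsCompact ((U : Set G)ᶜ) := hU.isClosed_compl.isCompact
  let ι := {W : Subgroup G // P W}
  let cover : ι → Set G := fun W => ((W.1 : Subgroup G) : Set G)ᶜ
  have hopen : ∀ i, IsOpen (cover i) := fun i => (hP i.1 i.2).isOpen_compl
  have hcov : (U : Set G)ᶜ ⊆ ⋃ i, cover i := by
    intro x hx
    by_contra h
    apply hx
    apply hle
    intro W hW
    by_contra hxW
    exact h (Set.mem_iUnion.mpr ⟨⟨W, hW⟩, hxW⟩)
  obtain ⟨t, ht⟩ := hcpt.elim_finite_subcover cover hopen hcov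
  refine ⟨t.image (fun i : ι => (i.1 : Subgroup G)), ?_, ?_⟩
  · intro W hW
    obtain ⟨i, -, rfl⟩ := Finset.mem_image.mp hW
    exact i.2
  · intro x hx
    by_contra hxU
    obtain ⟨i, hit, hi⟩ := Set.mem_iUnion₂.mp (ht hxU)
    exact hi (hx _ (Finset.mem_image.mpr ⟨i, hit, rfl⟩))

/-! ### The family of open normal `Σ`-index subgroups is closed under finite intersections -/

omit [TopologicalSpace G] in
/-- Membership in a finite infimum of subgroups. [cite: MochizukiAbsTopI2012, Def 1.1 (iii) p.10] -/
theorem mem_finset_inf_iff (F : Finset (Subgroup G)) (x : G) :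
    x ∈ F.inf id ↔ ∀ W ∈ F, x ∈ W := by
  classical
  induction F using Finset.induction_on with
  | empty => simp
  | insert W F hW ih =>
      rw [Finset.inf_insert, Subgroup.mem_inf]
      simp only [id, Finset.mem_insert, forall_eq_or_imp]
      exact and_congr Iff.rfl ih

/-- A finite intersection of open normal subgroups of `Σ`-integer index is an open normal subgroup of
`Σ`-integer index (indices multiply up to divisibility: `[G : U ∩ V] ∣ [G : U]·[G : V]` for `U` normal).
[cite: MochizukiAbsTopI2012, Def 1.1 (iii) p.10] -/
theorem finset_inf_normal_isOpen_isSigmaInteger [IsTopologicalGroup G] {S : Set ℕ}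
    (F : Finset (Subgroup G))
    (hF : ∀ W ∈ F, W.Normal ∧ IsOpen (W : Set G) ∧ IsSigmaInteger S W.index) :
    (F.inf id).Normal ∧ IsOpen ((F.inf id : Subgroup G) : Set G) ∧ IsSigmaInteger S (F.inf id).index := by
  classical
  induction F using Finset.induction_on with
  | empty =>
      refine ⟨?_, ?_, ?_⟩
      · rw [Finset.inf_empty]; infer_instance
      · rw [Finset.inf_empty]; exact isOpen_univ
      · rw [Finset.inf_empty, Subgroup.index_top]; exact IsSigmaInteger.one S
  | insert W F hW ih =>
      have hW' := hF W (Finset.mem_insert_self W F)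
      have ih' := ih fun W' hW'F => hF W' (Finset.mem_insert_of_mem hW'F)
      haveI : W.Normal := hW'.1
      haveI : (F.inf id).Normal := ih'.1
      refine ⟨?_, ?_, ?_⟩
      · rw [Finset.inf_insert]; change (W ⊓ F.inf id).Normal; infer_instance
      · rw [Finset.inf_insert]; exact hW'.2.1.inter ih'.2.1
      · rw [Finset.inf_insert]
        change IsSigmaInteger S (W ⊓ F.inf id).index
        exact IsSigmaInteger.index_inf hW'.2.2 ih'.2.2

/-! ### The kernel `K` of the maximal pro-`Σ` quotient -/

section Kernel

variable [IsTopologicalGroup G] {S : Set ℕ} {K : Subgroup G}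

omit [IsTopologicalGroup G] in
/-- `K = R_Σ(G)` is contained in every open normal subgroup of `Σ`-integer index (one direction of the
defining property, the one used below). [cite: MochizukiAbsTopI2012, Def 1.1 (iii) p.10] -/
theorem le_of_mem_family
    (hK : ∀ x, x ∈ K ↔ ∀ W : Subgroup G, W.Normal → IsOpen (W : Set G) → IsSigmaInteger S W.index → x ∈ W)
    {W : Subgroup G} (hWn : W.Normal) (hWo : IsOpen (W : Set G)) (hWS : IsSigmaInteger S W.index) :
    K ≤ W := fun x hx => (hK x).mp hx W hWn hWo hWS

omit [IsTopologicalGroup G] in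
/-- `K = R_Σ(G)` is a normal subgroup. [cite: MochizukiAbsTopI2012, Def 1.1 (iii) p.10] -/
theorem normal_of_mem_family
    (hK : ∀ x, x ∈ K ↔ ∀ W : Subgroup G, W.Normal → IsOpen (W : Set G) → IsSigmaInteger S W.index → x ∈ W) :
    K.Normal := by
  refine ⟨fun x hx g => (hK _).mpr fun W hWn hWo hWS => ?_⟩
  exact hWn.conj_mem x ((hK x).mp hx W hWn hWo hWS) g

/-- `K = R_Σ(G)` is closed (an intersection of open, hence closed, subgroups).
[cite: MochizukiAbsTopI2012, Def 1.1 (iii) p.10] -/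
theorem isClosed_of_mem_family
    (hK : ∀ x, x ∈ K ↔ ∀ W : Subgroup G, W.Normal → IsOpen (W : Set G) → IsSigmaInteger S W.index → x ∈ W) :
    IsClosed (K : Set G) := by
  have hset : (K : Set G) = ⋂ (W : Subgroup G) (_ : W.Normal ∧ IsOpen (W : Set G) ∧ IsSigmaInteger S W.index),
      (W : Set G) := by
    ext x
    simp only [SetLike.mem_coe, Set.mem_iInter]
    exact ⟨fun hx W hW => (hK x).mp hx W hW.1 hW.2.1 hW.2.2,
      fun h => (hK x).mpr fun W hWn hWo hWS => h W ⟨hWn, hWo, hWS⟩⟩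
  rw [hset]
  exact isClosed_iInter fun W => isClosed_iInter fun hW => Subgroup.isClosed_of_isOpen W hW.2.1

/-- Step 1 of the main argument: for `V ⊆ K` open in `K` there is an open NORMAL subgroup `C` of the
profinite group `G` with `C ∩ K ⊆ V`. [cite: MochizukiAbsTopI2012, Def 1.1 (iii) p.10] -/
theorem exists_open_normal_inf_le [CompactSpace G] [T2Space G] [TotallyDisconnectedSpace G]
    {V : Subgroup G} (hVo : IsOpen ((V.subgroupOf K : Subgroup K) : Set K)) :
    ∃ C : Subgroup G, C.Normal ∧ IsOpen (C : Set G) ∧ C ⊓ K ≤ V := by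
  -- `V = K ∩ O` for an open set `O ⊆ G`
  obtain ⟨O, hOo, hOV⟩ := isOpen_induced_iff.mp hVo
  have h1O : (1 : G) ∈ O := by
    have : (1 : K) ∈ (Subtype.val ⁻¹' O : Set K) := by
      rw [hOV]; exact (V.subgroupOf K).one_mem
    exact this
  obtain ⟨C, hC⟩ := ProfiniteGrp.exist_openNormalSubgroup_sub_open_nhds_of_one hOo h1O
  refine ⟨C.toOpenSubgroup.toSubgroup, C.isNormal', C.toOpenSubgroup.isOpen, ?_⟩
  intro x hx
  have hxO : x ∈ O := hC hx.1
  have hxK : x ∈ K := hx.2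
  have : (⟨x, hxK⟩ : K) ∈ (Subtype.val ⁻¹' O : Set K) := hxO
  rw [hOV] at this
  have h2 : (⟨x, hxK⟩ : K) ∈ V.subgroupOf K := this
  exact Subgroup.mem_subgroupOf.mp h2

/-! ### Normal subgroups "inside `L`": two bookkeeping helpers -/

omit [TopologicalSpace G] [IsTopologicalGroup G] in
/-- From `(A.subgroupOf L).Normal`: `A` is stable under conjugation by `L`.
[cite: MochizukiAbsTopI2012, Def 1.1 (iii) p.10] -/
theorem conj_mem_of_subgroupOf_normal {A L : Subgroup G} (hAL : A ≤ L) (hAn : (A.subgroupOf L).Normal)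
    {x k : G} (hx : x ∈ A) (hk : k ∈ L) : k * x * k⁻¹ ∈ A := by
  have h := hAn.conj_mem ⟨x, hAL hx⟩ (Subgroup.mem_subgroupOf.mpr hx) ⟨k, hk⟩
  rw [Subgroup.mem_subgroupOf] at h
  exact h

omit [TopologicalSpace G] [IsTopologicalGroup G] in
/-- Conversely, stability under conjugation by `L` gives `(A.subgroupOf L).Normal`.
[cite: MochizukiAbsTopI2012, Def 1.1 (iii) p.10] -/
theorem subgroupOf_normal_of_conj_mem {A L : Subgroup G}
    (h : ∀ x ∈ A, ∀ k ∈ L, k * x * k⁻¹ ∈ A) : (A.subgroupOf L).Normal := by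
  refine ⟨fun x hx k => ?_⟩
  rw [Subgroup.mem_subgroupOf] at hx ⊢
  exact h _ hx _ k.2

/-! ### Main theorem: `K` has no proper open normal subgroups of `Σ`-integer index -/

/-- **The kernel `K` of the maximal pro-`Σ` quotient has no nontrivial finite `Σ`-quotients**: if
`K = ⋂ {W ⊴ G open, [G : W] a Σ-integer}` (membership hypothesis `hK`) in a profinite group `G`, then
every subgroup `V ⊆ K` that is normal and open in `K` with `[K : V]` a `Σ`-integer is all of `K`.
Proof ("pro-`Σ` by pro-`Σ` is pro-`Σ`", read in a finite quotient): choose an open normal `C ⊴ G` with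
`C ∩ K ⊆ V`; in `Ḡ = G/C` let `R` be the intersection of the `K̄`-normal subgroups of `K̄` of `Σ`-integer
index (a finite intersection, so again of `Σ`-integer index in `K̄`, and `R ⊆ V̄`); `R` is normal in `Ḡ`
(the family is permuted by conjugation) and `[Ḡ : R] = [Ḡ : K̄]·[K̄ : R]` is a `Σ`-integer
(`[Ḡ : K̄] = [G : KC]` divides the index of a finite intersection of members of the defining family, by
compactness); hence the preimage of `R` belongs to the defining family, so `K̄ ⊆ R ⊆ V̄`, i.e. `K ⊆ VC`,
and `K ⊆ V` by `C ∩ K ⊆ V`. [cite: MochizukiAbsTopI2012, Def 1.1 (iii) p.10] -/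
theorem le_of_isSigmaInteger_relIndex [CompactSpace G] [T2Space G] [TotallyDisconnectedSpace G]
    (hK : ∀ x, x ∈ K ↔ ∀ W : Subgroup G, W.Normal → IsOpen (W : Set G) → IsSigmaInteger S W.index → x ∈ W)
    {V : Subgroup G} (hVK : V ≤ K) (hVn : (V.subgroupOf K).Normal)
    (hVo : IsOpen ((V.subgroupOf K : Subgroup K) : Set K)) (hVS : IsSigmaInteger S (V.relIndex K)) :
    K ≤ V := by
  classical
  haveI hKn : K.Normal := normal_of_mem_family hK
  obtain ⟨C, hCn, hCo, hCK⟩ := exists_open_normal_inf_le (K := K) hVo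
  haveI := hCn
  -- the finite quotient `Ḡ = G / C`
  haveI : Finite (G ⧸ C) := Subgroup.quotient_finite_of_isOpen C hCo
  let π : G →* G ⧸ C := QuotientGroup.mk' C
  have hπ : Function.Surjective π := QuotientGroup.mk'_surjective C
  have hπker : π.ker = C := QuotientGroup.ker_mk' C
  let Kb : Subgroup (G ⧸ C) := K.map π
  let Vb : Subgroup (G ⧸ C) := V.map π
  haveI hKbn : Kb.Normal := Subgroup.Normal.map hKn π hπ
  have hVbKb : Vb ≤ Kb := Subgroup.map_mono hVK
  have hmemKb : ∀ {y}, y ∈ Kb ↔ ∃ k ∈ K, π k = y := fun {y} => Subgroup.mem_map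
  have hmemVb : ∀ {y}, y ∈ Vb ↔ ∃ v ∈ V, π v = y := fun {y} => Subgroup.mem_map
  -- the family `𝒜` of `K̄`-normal subgroups of `K̄` with `Σ`-integer relative index
  let 𝒜 : Set (Subgroup (G ⧸ C)) :=
    {A | A ≤ Kb ∧ (A.subgroupOf Kb).Normal ∧ IsSigmaInteger S (A.relIndex Kb)}
  haveI : Finite (Set (G ⧸ C)) := inferInstance
  haveI : Finite (Subgroup (G ⧸ C)) :=
    Finite.of_injective (fun A : Subgroup (G ⧸ C) => (A : Set (G ⧸ C))) SetLike.coe_injective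
  have h𝒜fin : 𝒜.Finite := Set.toFinite 𝒜
  let F : Finset (Subgroup (G ⧸ C)) := h𝒜fin.toFinset
  have hF : ∀ {A}, A ∈ F ↔ A ∈ 𝒜 := fun {A} => h𝒜fin.mem_toFinset
  let R : Subgroup (G ⧸ C) := Kb ⊓ F.inf id
  have hRKb : R ≤ Kb := inf_le_left
  have hmemR : ∀ {y}, y ∈ R ↔ y ∈ Kb ∧ ∀ A ∈ 𝒜, y ∈ A := by
    intro y
    rw [Subgroup.mem_inf, mem_finset_inf_iff]
    exact and_congr Iff.rfl ⟨fun h A hA => h A (hF.mpr hA), fun h A hA => h A (hF.mp hA)⟩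
  -- (a) `V̄ ∈ 𝒜`, hence `R ≤ V̄`
  have hVb𝒜 : Vb ∈ 𝒜 := by
    refine ⟨hVbKb, subgroupOf_normal_of_conj_mem fun y hy k hk => ?_, ?_⟩
    · obtain ⟨v, hv, rfl⟩ := hmemVb.mp hy
      obtain ⟨x, hx, rfl⟩ := hmemKb.mp hk
      refine hmemVb.mpr ⟨x * v * x⁻¹, conj_mem_of_subgroupOf_normal hVK hVn hv hx, ?_⟩
      simp only [map_mul, map_inv]
    · -- `[K̄ : V̄] ∣ [K : V]` along the surjection `K ↠ K̄`
      refine hVS.of_dvd ?_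
      let πK : K →* Kb := π.subgroupMap K
      have hπK : Function.Surjective πK := π.subgroupMap_surjective K
      have hmap : (V.subgroupOf K).map πK = Vb.subgroupOf Kb := by
        ext ⟨y, hy⟩
        constructor
        · rintro ⟨x, hx, hxy⟩
          have hx' : (x : G) ∈ V := Subgroup.mem_subgroupOf.mp hx
          rw [Subgroup.mem_subgroupOf]
          have : π (x : G) = y := congrArg Subtype.val hxy
          exact hmemVb.mpr ⟨x, hx', this⟩
        · intro hy'
          rw [Subgroup.mem_subgroupOf] at hy'
          obtain ⟨v, hv, hvy⟩ := hmemVb.mp hy'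
          refine ⟨⟨v, hVK hv⟩, Subgroup.mem_subgroupOf.mpr hv, Subtype.ext ?_⟩
          exact hvy
      have h1 : Vb.relIndex Kb = ((V.subgroupOf K).map πK).index := by
        rw [hmap]; rfl
      rw [h1]
      exact (V.subgroupOf K).index_map_dvd hπK
  have hRVb : R ≤ Vb := fun y hy => ((hmemR.mp hy).2 Vb hVb𝒜)
  -- (b) `R` is normal in `Ḡ`: conjugation by `ḡ` permutes `𝒜`
  have hconj𝒜 : ∀ (g : G ⧸ C) {A}, A ∈ 𝒜 → A.comap (MulAut.conj g).toMonoidHom ∈ 𝒜 := by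
    intro g A hA
    obtain ⟨hAKb, hAn, hAS⟩ := hA
    have hmem : ∀ {x}, x ∈ A.comap (MulAut.conj g).toMonoidHom ↔ g * x * g⁻¹ ∈ A := by
      intro x; rw [Subgroup.mem_comap]; rfl
    refine ⟨fun x hx => ?_, subgroupOf_normal_of_conj_mem fun x hx k hk => ?_, ?_⟩
    · have h1 : g * x * g⁻¹ ∈ Kb := hAKb (hmem.mp hx)
      have h2 := hKbn.conj_mem _ h1 g⁻¹
      simpa [mul_assoc] using h2
    · rw [hmem] at hx ⊢
      have hk' : g * k * g⁻¹ ∈ Kb := hKbn.conj_mem _ hk g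
      have h3 := conj_mem_of_subgroupOf_normal hAKb hAn hx hk'
      have heq : g * k * g⁻¹ * (g * x * g⁻¹) * (g * k * g⁻¹)⁻¹ = g * (k * x * k⁻¹) * g⁻¹ := by group
      rw [heq] at h3
      exact h3
    · have hKbmap : Kb.map (MulAut.conj g).toMonoidHom = Kb := by
        ext y
        constructor
        · rintro ⟨x, hx, rfl⟩
          exact hKbn.conj_mem _ hx g
        · intro hy
          refine ⟨g⁻¹ * y * g⁻¹⁻¹, by simpa using hKbn.conj_mem _ hy g⁻¹, ?_⟩
          change g * (g⁻¹ * y * g⁻¹⁻¹) * g⁻¹ = y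
          group
      rw [Subgroup.relIndex_comap, hKbmap]
      exact hAS
  haveI hRn : R.Normal := by
    refine ⟨fun y hy g => hmemR.mpr ⟨hKbn.conj_mem _ (hmemR.mp hy).1 g, fun A hA => ?_⟩⟩
    have h := (hmemR.mp hy).2 _ (hconj𝒜 g hA)
    rw [Subgroup.mem_comap] at h
    exact h
  -- (b') `[K̄ : R]` is a `Σ`-integer: finite intersections inside `K̄`
  have hstep : ∀ F' : Finset (Subgroup (G ⧸ C)), (∀ A ∈ F', A ∈ 𝒜) →
      ((Kb ⊓ F'.inf id).subgroupOf Kb).Normal ∧ IsSigmaInteger S ((Kb ⊓ F'.inf id).relIndex Kb) := by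
    intro F'
    induction F' using Finset.induction_on with
    | empty =>
        intro _
        rw [Finset.inf_empty]
        have htop : (Kb ⊓ ⊤ : Subgroup (G ⧸ C)) = Kb := inf_top_eq Kb
        rw [htop, Subgroup.subgroupOf_self, Subgroup.relIndex_self]
        exact ⟨inferInstance, IsSigmaInteger.one S⟩
    | insert A F' hA ih =>
        intro hall
        obtain ⟨hAKb, hAn, hAS⟩ := hall A (Finset.mem_insert_self A F')
        obtain ⟨hBn, hBS⟩ := ih fun A' hA' => hall A' (Finset.mem_insert_of_mem hA')
        set B : Subgroup (G ⧸ C) := Kb ⊓ F'.inf id with hBdef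
        have hBKb : B ≤ Kb := inf_le_left
        have hAB : Kb ⊓ (insert A F').inf id = A ⊓ B := by
          rw [Finset.inf_insert, hBdef]
          change Kb ⊓ (A ⊓ F'.inf id) = A ⊓ (Kb ⊓ F'.inf id)
          rw [← inf_assoc, inf_comm Kb A, inf_assoc]
        rw [hAB]
        refine ⟨subgroupOf_normal_of_conj_mem fun x hx k hk => ?_, ?_⟩
        · exact ⟨conj_mem_of_subgroupOf_normal hAKb hAn hx.1 hk,
            conj_mem_of_subgroupOf_normal hBKb hBn hx.2 hk⟩
        · -- `[K̄ : A ∩ B] = [B : A ∩ B]·[K̄ : B]` and `[B : A ∩ B] ∣ [K̄ : A]` (`A` normal in `K̄`)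
          have hmul : (A ⊓ B).relIndex Kb = A.relIndex B * B.relIndex Kb := by
            have h := Subgroup.relIndex_inf_mul_relIndex A B Kb
            rw [inf_of_le_left hBKb] at h
            exact h.symm
          have hdvd : A.relIndex B ∣ A.relIndex Kb := by
            haveI := hAn
            have h1 : (A.subgroupOf Kb).relIndex (B.subgroupOf Kb) ∣ (A.subgroupOf Kb).index :=
              Subgroup.relIndex_dvd_index_of_normal (A.subgroupOf Kb) (B.subgroupOf Kb)
            rwa [Subgroup.relIndex_subgroupOf hBKb] at h1
          rw [hmul]
          exact (hAS.mul hBS).of_dvd (Nat.mul_dvd_mul_right hdvd _)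
  have hRS : IsSigmaInteger S (R.relIndex Kb) := (hstep F fun A hA => hF.mp hA).2
  -- (b'') `[Ḡ : K̄] = [G : K ⊔ C]` is a `Σ`-integer, by compactness
  have hKbS : IsSigmaInteger S Kb.index := by
    have hidx : Kb.index = (K ⊔ C).index := by
      rw [Subgroup.index_map, hπker, MonoidHom.range_eq_top.mpr hπ, Subgroup.index_top, mul_one]
    have hopen : IsOpen ((K ⊔ C : Subgroup G) : Set G) :=
      Subgroup.isOpen_mono (le_sup_right : C ≤ K ⊔ C) hCo
    obtain ⟨F₀, hF₀P, hF₀le⟩ := exists_finset_of_isOpen_of_forall_mem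
      (fun W : Subgroup G => W.Normal ∧ IsOpen (W : Set G) ∧ IsSigmaInteger S W.index)
      (fun W hW => Subgroup.isClosed_of_isOpen W hW.2.1) (K ⊔ C) hopen
      (fun x hx => (le_sup_left : K ≤ K ⊔ C) ((hK x).mpr fun W hWn hWo hWS => hx W ⟨hWn, hWo, hWS⟩))
    obtain ⟨-, -, hF₀S⟩ := finset_inf_normal_isOpen_isSigmaInteger F₀ hF₀P
    have hle : F₀.inf id ≤ K ⊔ C := fun x hx => hF₀le x ((mem_finset_inf_iff F₀ x).mp hx)
    rw [hidx]
    exact hF₀S.of_dvd (Subgroup.index_dvd_of_le hle)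
  have hRidx : IsSigmaInteger S R.index := by
    rw [← Subgroup.relIndex_mul_index hRKb]
    exact hRS.mul hKbS
  -- (c) `W := π⁻¹(R)` is in the defining family, so `K ≤ W`
  let W : Subgroup G := R.comap π
  have hWn : W.Normal := inferInstance
  have hCW : C ≤ W := by
    intro x hx
    rw [Subgroup.mem_comap]
    have : π x = 1 := by rw [← MonoidHom.mem_ker, hπker]; exact hx
    rw [this]; exact R.one_mem
  have hWo : IsOpen (W : Set G) := Subgroup.isOpen_mono hCW hCo
  have hWS : IsSigmaInteger S W.index := by
    change IsSigmaInteger S (R.comap π).index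
    rw [Subgroup.index_comap_of_surjective R hπ]
    exact hRidx
  have hKW : K ≤ W := le_of_mem_family hK hWn hWo hWS
  -- (d) conclude: `K ≤ V·C` and `C ∩ K ≤ V`
  intro x hx
  have hxR : π x ∈ R := hKW hx
  obtain ⟨v, hv, hvx⟩ := hmemVb.mp (hRVb hxR)
  have hvx' : v⁻¹ * x ∈ C := by
    rw [← QuotientGroup.eq]; exact hvx
  have hvxV : v⁻¹ * x ∈ V := hCK ⟨hvx', K.mul_mem (K.inv_mem (hVK hv)) hx⟩
  have : x = v * (v⁻¹ * x) := by group
  rw [this]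
  exact V.mul_mem hv hvxV

end Kernel

end Literature.AnabelianGeometry.AbsoluteAnabelian

end
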